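import Summits.Ventures.PercRepro.C026PFunTwoLive

/-!
# The symmetrised pair values of two live vertices (p6, gen 17; mine-3 §35 (a))

With probe `c` bare and two live vertices `a, b` at band states `(x₁, K₁)`, `(x₂, K₂)`
(`0 ≤ x ≤ 1`, `K ≥ 0`, `K(2 − x) ≥ 2x − 1`, i.e. `K ≥ K_min(x)`), the `(P)`-summand of a
configuration is `twoLiveVal x₁ K₁ x₂ K₂ (c ~ a) (c ~ b) (a ~ b) (a ~_ωᶜ b)`
(`C026PFunTwoLive`), and the **symmetrised pair value** `val(ω) + val(ωᶜ)` depends only on the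
red type `π_r ∈ {A, B₁, B₂, C, D}` of `ω` and the blue type `π_b` of `ωᶜ` (`A = c|a|b`,
`B₁ = ca|b`, `B₂ = cb|a`, `C = c|ab`, `D = cab`).  mine-3 §35 (a): all fifteen pair values are
nonnegative on the band except `(A, D)`, which is nonnegative as soon as `½ ≤ x₁` or `½ ≤ x₂`.
This file proves the fifteen values (`pair_A_A` … `pair_D_D`; with `u = K₁(2 − x₁)`,
`w = K₂(2 − x₂)`, `u' = u − (2x₁ − 1) ≥ 0`, `w' = w − (2x₂ − 1) ≥ 0`, `P = (2 − x₁)(2 − x₂)`,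
`Q = 2 − x₁x₂` the exact certificates are, e.g., `(A, B₁) = (2 − x₂)u'`,
`(2 − x₁)·(B₁, C) = u'Q + 6(1 − x₁)²(1 − x₂)`,
`(2 − x₁)·(B₁, D) = u'Q + (2 − x₁)u'w + (2 − x₁)(2x₁ − 1)w' + 6(1 − x₁)²(1 − x₂)` for
`x₁, x₂ ≥ ½`, `P·(C, D) = u'wQ + (2x₁ − 1)w'Q + 6(1 − x₁)(1 − x₂)(1 − x₁x₂)` for
`x₁, x₂ ≥ ½`, `(A, D) = u'w + (2x₁ − 1)w'` for `x₁ ≥ ½`) and assembles them into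
`twoLiveVal_add_nonneg`: off the piece `x₁ ≤ ½ ∧ x₂ ≤ ½` every symmetrised pair value of every
consistent red / blue pattern is nonnegative.  THEOREM L2 (bare probe) is `C026PFunTwoLiveL2`.
-/

namespace PercRepro

/-- A band state in polynomial form: `0 ≤ x ≤ 1`, `K ≥ 0`, `K(2 − x) ≥ 2x − 1`. -/
structure BandState (x K : ℝ) : Prop where
  /-- `0 ≤ x` -/
  x0 : 0 ≤ x
  /-- `x ≤ 1` -/
  x1 : x ≤ 1
  /-- `0 ≤ K` -/
  K0 : 0 ≤ K
  /-- the band `K ≥ K_min(x)` cleared of its denominator -/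
  band : 2 * x - 1 ≤ K * (2 - x)

/-- The band `K ≥ K_min(x)` gives a `BandState`. -/
theorem bandState_of_kMin_le {x K : ℝ} (hx : 0 ≤ x ∧ x ≤ 1) (hK : kMin x ≤ K) : BandState x K := by
  refine ⟨hx.1, hx.2, (kMin_nonneg x).trans hK, ?_⟩
  rcases le_or_gt x (1 / 2) with h | h
  · have : 0 ≤ K := (kMin_nonneg x).trans hK
    nlinarith
  · rw [kMin_eq_of_half_le h.le hx.2, div_le_iff₀ (by linarith)] at hK
    exact hK

namespace MultiGraph

section Pairs

variable {x₁ K₁ x₂ K₂ : ℝ} (h₁ : BandState x₁ K₁) (h₂ : BandState x₂ K₂)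
  (ra rb rab ba bb bab : Prop) [Decidable ra] [Decidable rb] [Decidable rab] [Decidable ba]
  [Decidable bb] [Decidable bab]

include h₁ h₂

omit h₁ h₂ in
/-- Pair `(A, A)`: value `0`. -/
theorem pair_A_A (hra : ¬ra) (hrb : ¬rb) (hrab : ¬rab) (hba : ¬ba) (hbb : ¬bb) (hbab : ¬bab) :
    0 ≤ twoLiveVal x₁ K₁ x₂ K₂ ra rb rab bab + twoLiveVal x₁ K₁ x₂ K₂ ba bb bab rab := by
  unfold twoLiveVal
  simp only [hra, hrb, hrab, hba, hbb, hbab, if_false]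
  nlinarith

/-- Pair `(A, B₁)`: value `(2 − x₂)·u'`. -/
theorem pair_A_B₁ (hra : ¬ra) (hrb : ¬rb) (hrab : ¬rab) (hba : ba) (hbb : ¬bb) (hbab : ¬bab) :
    0 ≤ twoLiveVal x₁ K₁ x₂ K₂ ra rb rab bab + twoLiveVal x₁ K₁ x₂ K₂ ba bb bab rab := by
  unfold twoLiveVal
  simp only [hra, hrb, hrab, hba, hbb, hbab, if_true, if_false]
  have h2 : 0 ≤ 2 - x₂ := by linarith [h₂.x1]
  have hu : 0 ≤ K₁ * (2 - x₁) - (2 * x₁ - 1) := by linarith [h₁.band]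
  nlinarith [mul_nonneg h2 hu]

/-- Pair `(A, B₂)`: value `(2 − x₁)·w'`. -/
theorem pair_A_B₂ (hra : ¬ra) (hrb : ¬rb) (hrab : ¬rab) (hba : ¬ba) (hbb : bb) (hbab : ¬bab) :
    0 ≤ twoLiveVal x₁ K₁ x₂ K₂ ra rb rab bab + twoLiveVal x₁ K₁ x₂ K₂ ba bb bab rab := by
  unfold twoLiveVal
  simp only [hra, hrb, hrab, hba, hbb, hbab, if_true, if_false]
  have h1 : 0 ≤ 2 - x₁ := by linarith [h₁.x1]
  have hw : 0 ≤ K₂ * (2 - x₂) - (2 * x₂ - 1) := by linarith [h₂.band]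
  nlinarith [mul_nonneg h1 hw]

omit h₁ h₂ in
/-- Pair `(A, C)`: value `0`. -/
theorem pair_A_C (hra : ¬ra) (hrb : ¬rb) (hrab : ¬rab) (hba : ¬ba) (hbb : ¬bb) (hbab : bab) :
    0 ≤ twoLiveVal x₁ K₁ x₂ K₂ ra rb rab bab + twoLiveVal x₁ K₁ x₂ K₂ ba bb bab rab := by
  unfold twoLiveVal
  simp only [hra, hrb, hrab, hba, hbb, hbab, if_true, if_false]
  nlinarith

/-- Pair `(A, D)`: value `uw − (1 − 2x₁)(1 − 2x₂)`, nonnegative when `½ ≤ x₁` or `½ ≤ x₂`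
(the only pair value that is negative somewhere on the band). -/
theorem pair_A_D (hhalf : 1 / 2 ≤ x₁ ∨ 1 / 2 ≤ x₂) (hra : ¬ra) (hrb : ¬rb) (hrab : ¬rab)
    (hba : ba) (hbb : bb) (hbab : bab) :
    0 ≤ twoLiveVal x₁ K₁ x₂ K₂ ra rb rab bab + twoLiveVal x₁ K₁ x₂ K₂ ba bb bab rab := by
  unfold twoLiveVal
  simp only [hra, hrb, hrab, hba, hbb, hbab, if_true, if_false]
  have h1 : 0 ≤ 2 - x₁ := by linarith [h₁.x1]
  have h2 : 0 ≤ 2 - x₂ := by linarith [h₂.x1]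
  have hu : 0 ≤ K₁ * (2 - x₁) - (2 * x₁ - 1) := by linarith [h₁.band]
  have hw : 0 ≤ K₂ * (2 - x₂) - (2 * x₂ - 1) := by linarith [h₂.band]
  have hu0 : 0 ≤ K₁ * (2 - x₁) := mul_nonneg h₁.K0 h1
  have hw0 : 0 ≤ K₂ * (2 - x₂) := mul_nonneg h₂.K0 h2
  rcases hhalf with hh | hh
  · nlinarith [mul_nonneg hu hw0, mul_nonneg (by linarith : (0 : ℝ) ≤ 2 * x₁ - 1) hw]
  · nlinarith [mul_nonneg hw hu0, mul_nonneg (by linarith : (0 : ℝ) ≤ 2 * x₂ - 1) hu]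

/-- Pair `(B₁, B₁)`: value `2(2 − x₂)·u'`. -/
theorem pair_B₁_B₁ (hra : ra) (hrb : ¬rb) (hrab : ¬rab) (hba : ba) (hbb : ¬bb) (hbab : ¬bab) :
    0 ≤ twoLiveVal x₁ K₁ x₂ K₂ ra rb rab bab + twoLiveVal x₁ K₁ x₂ K₂ ba bb bab rab := by
  unfold twoLiveVal
  simp only [hra, hrb, hrab, hba, hbb, hbab, if_true, if_false]
  have h2 : 0 ≤ 2 - x₂ := by linarith [h₂.x1]
  have hu : 0 ≤ K₁ * (2 - x₁) - (2 * x₁ - 1) := by linarith [h₁.band]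
  nlinarith [mul_nonneg h2 hu]

/-- Pair `(B₁, B₂)`: value `(2 − x₂)·u' + (2 − x₁)·w'`. -/
theorem pair_B₁_B₂ (hra : ra) (hrb : ¬rb) (hrab : ¬rab) (hba : ¬ba) (hbb : bb) (hbab : ¬bab) :
    0 ≤ twoLiveVal x₁ K₁ x₂ K₂ ra rb rab bab + twoLiveVal x₁ K₁ x₂ K₂ ba bb bab rab := by
  unfold twoLiveVal
  simp only [hra, hrb, hrab, hba, hbb, hbab, if_true, if_false]
  have h1 : 0 ≤ 2 - x₁ := by linarith [h₁.x1]
  have h2 : 0 ≤ 2 - x₂ := by linarith [h₂.x1]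
  have hu : 0 ≤ K₁ * (2 - x₁) - (2 * x₁ - 1) := by linarith [h₁.band]
  have hw : 0 ≤ K₂ * (2 - x₂) - (2 * x₂ - 1) := by linarith [h₂.band]
  nlinarith [mul_nonneg h2 hu, mul_nonneg h1 hw]

/-- Pair `(B₂, B₂)`: value `2(2 − x₁)·w'`. -/
theorem pair_B₂_B₂ (hra : ¬ra) (hrb : rb) (hrab : ¬rab) (hba : ¬ba) (hbb : bb) (hbab : ¬bab) :
    0 ≤ twoLiveVal x₁ K₁ x₂ K₂ ra rb rab bab + twoLiveVal x₁ K₁ x₂ K₂ ba bb bab rab := by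
  unfold twoLiveVal
  simp only [hra, hrb, hrab, hba, hbb, hbab, if_true, if_false]
  have h1 : 0 ≤ 2 - x₁ := by linarith [h₁.x1]
  have hw : 0 ≤ K₂ * (2 - x₂) - (2 * x₂ - 1) := by linarith [h₂.band]
  nlinarith [mul_nonneg h1 hw]

/-- Pair `(B₁, C)`: `(2 − x₁)·value = u'Q + 6(1 − x₁)²(1 − x₂)`. -/
theorem pair_B₁_C (hra : ra) (hrb : ¬rb) (hrab : ¬rab) (hba : ¬ba) (hbb : ¬bb) (hbab : bab) :
    0 ≤ twoLiveVal x₁ K₁ x₂ K₂ ra rb rab bab + twoLiveVal x₁ K₁ x₂ K₂ ba bb bab rab := by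
  unfold twoLiveVal
  simp only [hra, hrb, hrab, hba, hbb, hbab, if_true, if_false]
  have h1' : 0 < 2 - x₁ := by linarith [h₁.x1]
  have hQ : 0 ≤ 2 - x₁ * x₂ := by nlinarith [h₁.x0, h₁.x1, h₂.x0, h₂.x1]
  have hu : 0 ≤ K₁ * (2 - x₁) - (2 * x₁ - 1) := by linarith [h₁.band]
  have e1 : 0 ≤ 1 - x₁ := by linarith [h₁.x1]
  have e2 : 0 ≤ 1 - x₂ := by linarith [h₂.x1]
  nlinarith [mul_nonneg hu hQ, mul_nonneg (mul_nonneg e1 e1) e2, h1']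

/-- Pair `(B₂, C)`: `(2 − x₂)·value = w'Q + 6(1 − x₂)²(1 − x₁)`. -/
theorem pair_B₂_C (hra : ¬ra) (hrb : rb) (hrab : ¬rab) (hba : ¬ba) (hbb : ¬bb) (hbab : bab) :
    0 ≤ twoLiveVal x₁ K₁ x₂ K₂ ra rb rab bab + twoLiveVal x₁ K₁ x₂ K₂ ba bb bab rab := by
  unfold twoLiveVal
  simp only [hra, hrb, hrab, hba, hbb, hbab, if_true, if_false]
  have h2' : 0 < 2 - x₂ := by linarith [h₂.x1]
  have hQ : 0 ≤ 2 - x₁ * x₂ := by nlinarith [h₁.x0, h₁.x1, h₂.x0, h₂.x1]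
  have hw : 0 ≤ K₂ * (2 - x₂) - (2 * x₂ - 1) := by linarith [h₂.band]
  have e1 : 0 ≤ 1 - x₁ := by linarith [h₁.x1]
  have e2 : 0 ≤ 1 - x₂ := by linarith [h₂.x1]
  nlinarith [mul_nonneg hw hQ, mul_nonneg (mul_nonneg e2 e2) e1, h2']

/-- Pair `(B₁, D)`: value `3 − 4x₁ − x₂ + K₁Q + uw`. -/
theorem pair_B₁_D (hra : ra) (hrb : ¬rb) (hrab : ¬rab) (hba : ba) (hbb : bb) (hbab : bab) :
    0 ≤ twoLiveVal x₁ K₁ x₂ K₂ ra rb rab bab + twoLiveVal x₁ K₁ x₂ K₂ ba bb bab rab := by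
  unfold twoLiveVal
  simp only [hra, hrb, hrab, hba, hbb, hbab, if_true, if_false]
  have h1 : 0 ≤ 2 - x₁ := by linarith [h₁.x1]
  have h2 : 0 ≤ 2 - x₂ := by linarith [h₂.x1]
  have h1' : 0 < 2 - x₁ := by linarith [h₁.x1]
  have hQ : 0 ≤ 2 - x₁ * x₂ := by nlinarith [h₁.x0, h₁.x1, h₂.x0, h₂.x1]
  have hu : 0 ≤ K₁ * (2 - x₁) - (2 * x₁ - 1) := by linarith [h₁.band]
  have hw : 0 ≤ K₂ * (2 - x₂) - (2 * x₂ - 1) := by linarith [h₂.band]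
  have hw0 : 0 ≤ K₂ * (2 - x₂) := mul_nonneg h₂.K0 h2
  have e1 : 0 ≤ 1 - x₁ := by linarith [h₁.x1]
  have e2 : 0 ≤ 1 - x₂ := by linarith [h₂.x1]
  have hK₁Q : 0 ≤ K₁ * (2 - x₁ * x₂) := mul_nonneg h₁.K0 hQ
  have huw : 0 ≤ K₁ * (2 - x₁) * (K₂ * (2 - x₂)) := mul_nonneg (mul_nonneg h₁.K0 h1) hw0
  rcases le_or_gt x₁ (1 / 2) with hx | hx
  · nlinarith [hK₁Q, huw, h₂.x1]
  rcases le_or_gt x₂ (1 / 2) with hy | hy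
  · have hsq : 0 ≤ x₁ ^ 2 - x₁ + 1 := by nlinarith [sq_nonneg (x₁ - 1 / 2)]
    nlinarith [mul_nonneg (by linarith : (0 : ℝ) ≤ 1 - 2 * x₂) hsq, mul_nonneg e1 e1,
      mul_nonneg hu hQ, mul_nonneg h1 huw, h1']
  · nlinarith [mul_nonneg hu hQ, mul_nonneg h1 (mul_nonneg hu hw0),
      mul_nonneg (mul_nonneg h1 (by linarith : (0 : ℝ) ≤ 2 * x₁ - 1)) hw,
      mul_nonneg (mul_nonneg e1 e1) e2, h1']

/-- Pair `(B₂, D)`: value `3 − 4x₂ − x₁ + K₂Q + uw`. -/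
theorem pair_B₂_D (hra : ¬ra) (hrb : rb) (hrab : ¬rab) (hba : ba) (hbb : bb) (hbab : bab) :
    0 ≤ twoLiveVal x₁ K₁ x₂ K₂ ra rb rab bab + twoLiveVal x₁ K₁ x₂ K₂ ba bb bab rab := by
  unfold twoLiveVal
  simp only [hra, hrb, hrab, hba, hbb, hbab, if_true, if_false]
  have h1 : 0 ≤ 2 - x₁ := by linarith [h₁.x1]
  have h2 : 0 ≤ 2 - x₂ := by linarith [h₂.x1]
  have h2' : 0 < 2 - x₂ := by linarith [h₂.x1]
  have hQ : 0 ≤ 2 - x₁ * x₂ := by nlinarith [h₁.x0, h₁.x1, h₂.x0, h₂.x1]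
  have hu : 0 ≤ K₁ * (2 - x₁) - (2 * x₁ - 1) := by linarith [h₁.band]
  have hw : 0 ≤ K₂ * (2 - x₂) - (2 * x₂ - 1) := by linarith [h₂.band]
  have hu0 : 0 ≤ K₁ * (2 - x₁) := mul_nonneg h₁.K0 h1
  have e1 : 0 ≤ 1 - x₁ := by linarith [h₁.x1]
  have e2 : 0 ≤ 1 - x₂ := by linarith [h₂.x1]
  have hK₂Q : 0 ≤ K₂ * (2 - x₁ * x₂) := mul_nonneg h₂.K0 hQ
  have huw : 0 ≤ K₁ * (2 - x₁) * (K₂ * (2 - x₂)) := mul_nonneg hu0 (mul_nonneg h₂.K0 h2)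
  rcases le_or_gt x₂ (1 / 2) with hy | hy
  · nlinarith [hK₂Q, huw, h₁.x1]
  rcases le_or_gt x₁ (1 / 2) with hx | hx
  · have hsq : 0 ≤ x₂ ^ 2 - x₂ + 1 := by nlinarith [sq_nonneg (x₂ - 1 / 2)]
    nlinarith [mul_nonneg (by linarith : (0 : ℝ) ≤ 1 - 2 * x₁) hsq, mul_nonneg e2 e2,
      mul_nonneg hw hQ, mul_nonneg h2 huw, h2']
  · nlinarith [mul_nonneg hw hQ, mul_nonneg h2 (mul_nonneg hw hu0),
      mul_nonneg (mul_nonneg h2 (by linarith : (0 : ℝ) ≤ 2 * x₂ - 1)) hu,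
      mul_nonneg (mul_nonneg e2 e2) e1, h2']

omit h₁ h₂ in
/-- Pair `(C, C)`: value `0`. -/
theorem pair_C_C (hra : ¬ra) (hrb : ¬rb) (hrab : rab) (hba : ¬ba) (hbb : ¬bb) (hbab : bab) :
    0 ≤ twoLiveVal x₁ K₁ x₂ K₂ ra rb rab bab + twoLiveVal x₁ K₁ x₂ K₂ ba bb bab rab := by
  unfold twoLiveVal
  simp only [hra, hrb, hrab, hba, hbb, hbab, if_true, if_false]
  nlinarith

/-- The `(C, D)` value `1 − 2x₁x₂ + K₁K₂Q` is nonnegative on the band. -/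
theorem cd_value_nonneg : 0 ≤ 1 - 2 * x₁ * x₂ + K₁ * K₂ * (2 - x₁ * x₂) := by
  have h1 : 0 ≤ 2 - x₁ := by linarith [h₁.x1]
  have h2 : 0 ≤ 2 - x₂ := by linarith [h₂.x1]
  have hQ : 0 ≤ 2 - x₁ * x₂ := by nlinarith [h₁.x0, h₁.x1, h₂.x0, h₂.x1]
  have hu : 0 ≤ K₁ * (2 - x₁) - (2 * x₁ - 1) := by linarith [h₁.band]
  have hw : 0 ≤ K₂ * (2 - x₂) - (2 * x₂ - 1) := by linarith [h₂.band]
  have hw0 : 0 ≤ K₂ * (2 - x₂) := mul_nonneg h₂.K0 h2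
  have e1 : 0 ≤ 1 - x₁ := by linarith [h₁.x1]
  have e2 : 0 ≤ 1 - x₂ := by linarith [h₂.x1]
  have e12 : 0 ≤ 1 - x₁ * x₂ := by nlinarith [h₁.x0, h₁.x1, h₂.x0, h₂.x1]
  have hKKQ : 0 ≤ K₁ * K₂ * (2 - x₁ * x₂) := mul_nonneg (mul_nonneg h₁.K0 h₂.K0) hQ
  have hP' : 0 < (2 - x₁) * (2 - x₂) := by nlinarith [h₁.x1, h₂.x1]
  rcases le_or_gt x₁ (1 / 2) with hx | hx
  · nlinarith [hKKQ, mul_nonneg (by linarith : (0 : ℝ) ≤ 1 - 2 * x₁) h₂.x0]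
  rcases le_or_gt x₂ (1 / 2) with hy | hy
  · nlinarith [hKKQ, mul_nonneg (by linarith : (0 : ℝ) ≤ 1 - 2 * x₂) h₁.x0]
  · nlinarith [mul_nonneg (mul_nonneg hu hw0) hQ,
      mul_nonneg (mul_nonneg (by linarith : (0 : ℝ) ≤ 2 * x₁ - 1) hw) hQ,
      mul_nonneg (mul_nonneg e1 e2) e12, hP']

/-- Pair `(C, D)`: value `1 − 2x₁x₂ + K₁K₂Q`. -/
theorem pair_C_D (hra : ¬ra) (hrb : ¬rb) (hrab : rab) (hba : ba) (hbb : bb) (hbab : bab) :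
    0 ≤ twoLiveVal x₁ K₁ x₂ K₂ ra rb rab bab + twoLiveVal x₁ K₁ x₂ K₂ ba bb bab rab := by
  unfold twoLiveVal
  simp only [hra, hrb, hrab, hba, hbb, hbab, if_true, if_false]
  nlinarith [cd_value_nonneg h₁ h₂]

/-- Pair `(D, D)`: value `2(1 − 2x₁x₂ + K₁K₂Q)`. -/
theorem pair_D_D (hra : ra) (hrb : rb) (hrab : rab) (hba : ba) (hbb : bb) (hbab : bab) :
    0 ≤ twoLiveVal x₁ K₁ x₂ K₂ ra rb rab bab + twoLiveVal x₁ K₁ x₂ K₂ ba bb bab rab := by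
  unfold twoLiveVal
  simp only [hra, hrb, hrab, hba, hbb, hbab, if_true]
  nlinarith [cd_value_nonneg h₁ h₂]

end Pairs

/-- **The symmetrised pair values are nonnegative off the piece `x₁, x₂ ≤ ½`** (mine-3 §35 (a)):
for band states with `½ ≤ x₁` or `½ ≤ x₂` and any consistent red / blue patterns,
`val(ω) + val(ωᶜ) ≥ 0`. -/
theorem twoLiveVal_add_nonneg {x₁ K₁ x₂ K₂ : ℝ} (h₁ : BandState x₁ K₁) (h₂ : BandState x₂ K₂)
    (hhalf : 1 / 2 ≤ x₁ ∨ 1 / 2 ≤ x₂)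
    (ra rb rab ba bb bab : Prop) [Decidable ra] [Decidable rb] [Decidable rab] [Decidable ba]
    [Decidable bb] [Decidable bab] (r1 : ra → rb → rab) (r2 : ra → rab → rb) (r3 : rb → rab → ra)
    (b1 : ba → bb → bab) (b2 : ba → bab → bb) (b3 : bb → bab → ba) :
    0 ≤ twoLiveVal x₁ K₁ x₂ K₂ ra rb rab bab + twoLiveVal x₁ K₁ x₂ K₂ ba bb bab rab := by
  by_cases hra : ra <;> by_cases hrb : rb <;> by_cases hrab : rab <;> by_cases hba : ba <;>
    by_cases hbb : bb <;> by_cases hbab : bab <;>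
    first
    | exact absurd (r1 hra hrb) hrab
    | exact absurd (r2 hra hrab) hrb
    | exact absurd (r3 hrb hrab) hra
    | exact absurd (b1 hba hbb) hbab
    | exact absurd (b2 hba hbab) hbb
    | exact absurd (b3 hbb hbab) hba
    | exact pair_A_A _ _ _ _ _ _ hra hrb hrab hba hbb hbab
    | exact pair_A_B₁ h₁ h₂ _ _ _ _ _ _ hra hrb hrab hba hbb hbab
    | exact pair_A_B₂ h₁ h₂ _ _ _ _ _ _ hra hrb hrab hba hbb hbab
    | exact pair_A_C _ _ _ _ _ _ hra hrb hrab hba hbb hbab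
    | exact pair_A_D h₁ h₂ _ _ _ _ _ _ hhalf hra hrb hrab hba hbb hbab
    | exact pair_B₁_B₁ h₁ h₂ _ _ _ _ _ _ hra hrb hrab hba hbb hbab
    | exact pair_B₁_B₂ h₁ h₂ _ _ _ _ _ _ hra hrb hrab hba hbb hbab
    | exact pair_B₂_B₂ h₁ h₂ _ _ _ _ _ _ hra hrb hrab hba hbb hbab
    | exact pair_B₁_C h₁ h₂ _ _ _ _ _ _ hra hrb hrab hba hbb hbab
    | exact pair_B₂_C h₁ h₂ _ _ _ _ _ _ hra hrb hrab hba hbb hbab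
    | exact pair_B₁_D h₁ h₂ _ _ _ _ _ _ hra hrb hrab hba hbb hbab
    | exact pair_B₂_D h₁ h₂ _ _ _ _ _ _ hra hrb hrab hba hbb hbab
    | exact pair_C_C _ _ _ _ _ _ hra hrb hrab hba hbb hbab
    | exact pair_C_D h₁ h₂ _ _ _ _ _ _ hra hrb hrab hba hbb hbab
    | exact pair_D_D h₁ h₂ _ _ _ _ _ _ hra hrb hrab hba hbb hbab
    | (rw [add_comm]; exact pair_A_B₁ h₁ h₂ _ _ _ _ _ _ hba hbb hbab hra hrb hrab)
    | (rw [add_comm]; exact pair_A_B₂ h₁ h₂ _ _ _ _ _ _ hba hbb hbab hra hrb hrab)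
    | (rw [add_comm]; exact pair_A_C _ _ _ _ _ _ hba hbb hbab hra hrb hrab)
    | (rw [add_comm]; exact pair_A_D h₁ h₂ _ _ _ _ _ _ hhalf hba hbb hbab hra hrb hrab)
    | (rw [add_comm]; exact pair_B₁_B₂ h₁ h₂ _ _ _ _ _ _ hba hbb hbab hra hrb hrab)
    | (rw [add_comm]; exact pair_B₁_C h₁ h₂ _ _ _ _ _ _ hba hbb hbab hra hrb hrab)
    | (rw [add_comm]; exact pair_B₂_C h₁ h₂ _ _ _ _ _ _ hba hbb hbab hra hrb hrab)
    | (rw [add_comm]; exact pair_B₁_D h₁ h₂ _ _ _ _ _ _ hba hbb hbab hra hrb hrab)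
    | (rw [add_comm]; exact pair_B₂_D h₁ h₂ _ _ _ _ _ _ hba hbb hbab hra hrb hrab)
    | (rw [add_comm]; exact pair_C_D h₁ h₂ _ _ _ _ _ _ hba hbb hbab hra hrb hrab)

end MultiGraph

end PercRepro
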